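import Mathlib.Analysis.SpecialFunctions.Pow.Real
import Mathlib.Analysis.SpecialFunctions.Sqrt
import HarnessLib

/-!
# Venture YMGap — track (c) «DS», the vertex-STAR window with the GAUGE FIXED at the centre:
# the received sum `R_G(β_W) = 6c(1+c)/(1 − 4c − 6c²)` in closed rational form, the explicit
# resolvent column it comes from, the exact threshold `β_W < (√37 − 5)/3`, and kernel-checked rows

HONEST FRAMING: venture file (cell `pub-ymgap`, QuantumFields programme), strong-coupling LATTICE
bookkeeping only (currency SC-a: exponential clustering of local observables, uniformly in the
volume).  This file is PURE REAL ARITHMETIC.  It records the bookkeeping of the cell's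
`GAUGE-STAR.md` (ds-2): once the star law of the `SU(2)`, `d = 4` Wilson specification is read with
the gauge fixed at the centre link `a` (the law is invariant under left multiplication of the eight
star links; the response function `β_W⟨x_a, Ṫ x_b⟩` of a boundary move becomes the one-site linear
function `β_W⟨x_b, w̄⟩` of the partner link `b`), Föllmer's comparison theorem on the seven remaining
links with the one-link quarter modulus `c = β_W/4` per partner gives the influence vector
`c · D^{(a)}_{·b}`, `D^{(a)} = (I − c·Adj)⁻¹` on the seven links other than `a` (`Adj` = "spans a
plaquette with" = "is not the opposite link").  By the symmetry fixing `a` and `b` that column has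
four values — at `b`, at the opposite link `b̄`, at `ā`, and at the four generic links — namely

  `D_bb = 1 + c²(5+6c)/((1+2c)Δ)`, `D_b̄b = c²(5+6c)/((1+2c)Δ)`, `D_āb = c/Δ`,
  `D_gb = c(1+c)/((1+2c)Δ)`, `Δ = 1 − 4c − 6c²`,

and the 48-position count (6 pairs see a given link in position `b`, 6 in position `ā`, 6 in
position `b̄`, 24 in generic position, 6 in position `a` with weight `0`) gives the received sum

  `R_G(β_W) = c(6 D_bb + 6 D_āb + 6 D_b̄b + 24 D_gb) = 6c(1 + c)/(1 − 4c − 6c²)`, `c = β_W/4`.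

WHAT IS PROVED HERE (arithmetic only): the four displayed values solve the symmetry-reduced
resolvent equations `w = e_b + c·Adj·w` (`colB_eq_*`), are nonnegative below the pole, the count
identity `gaugeR_eq_count`, the exact threshold `gaugeR β < 1 ↔ 3β² + 10β < 4 ↔ β < (√37 − 5)/3`
on `0 ≤ β ≤ 7/10`, monotonicity-free rows `R_G(2/9) = 19/41`, `R_G(1/4) = 17/31`, `R_G(2/7) = 45/67`,
`R_G(1/3) = 13/15`, `R_G(7/20) = 1827/1933`, `R_G(9/25) < 1`, `1 ≤ R_G(13/36)`, and the clustering
rate `(1 − γ₀)²/(2(16γ₀ + 1)) = 2/3345` at `γ₀ = 13/15`.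

WHAT THIS IS NOT.  It does NOT prove that `R_G` bounds anything: the analytic statement «the star
window kernels of the `SU(2)`, `d = 4` Wilson specification satisfy `DSWindow.IsWindowKRContraction`
with an array whose received sums are `R_G(β_W)`» is the cell's LEMMA G (gauge invariance + Haar
disintegration + Föllmer's comparison theorem (Saint-Flour 1988, Ch. I (2.8), (2.17)–(2.21)) + the
one-link quarter modulus `OneLinkKRModulusSU2 β_W (1/4)`, in the tree for `β_W ≤ 1/3`), pen-and-paper,
referee audit pending, NOT asserted here.  With Lemma G, the tree's window theorem
`Literature.Probability.LatticeModels.DobrushinShlosman.abs_covariance_le` turns `R_G(β_W) < 1`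
into exponential clustering at that `β_W` — a strong-coupling lattice statement; nothing about
confinement, the continuum or the Yang–Mills mass gap.  Sibling file (the cell's earlier Lemma-S
bookkeeping with certified tables): `StarReceivedSum.lean`.

References (lineage of the bookkeeping, not of this arithmetic): R. L. Dobrushin, Theory Probab.
Appl. 15 (1970) Thm. 3; H. Föllmer, LNM 1362 (1988) Ch. I (2.8), (2.17)–(2.21);
R. L. Dobrushin, S. B. Shlosman (1985) condition `C_V`.
-/

noncomputable section

namespace Summit.Ventures.YMGap.StarWindowGauge

/-! ### The closed form -/

/-- `Δ(c) = 1 − 4c − 6c²`: the determinant factor of the symmetry-reduced resolvent of the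
seven-link Dobrushin matrix `c·Adj` (gauge fixed at one star link). [folklore] -/
def Delta (c : ℝ) : ℝ := 1 - 4 * c - 6 * c ^ 2

/-- Resolvent column at the partner link itself: `D_bb = 1 + c²(5+6c)/((1+2c)Δ)`. [folklore] -/
def Dbb (c : ℝ) : ℝ := 1 + c ^ 2 * (5 + 6 * c) / ((1 + 2 * c) * Delta c)

/-- Resolvent column at the link opposite to the partner: `D_b̄b = c²(5+6c)/((1+2c)Δ)`. [folklore] -/
def Dbbar (c : ℝ) : ℝ := c ^ 2 * (5 + 6 * c) / ((1 + 2 * c) * Delta c)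

/-- Resolvent column at the link opposite to the gauge-fixed one: `D_āb = c/Δ`. [folklore] -/
def Dabar (c : ℝ) : ℝ := c / Delta c

/-- Resolvent column at each of the four generic links: `D_gb = c(1+c)/((1+2c)Δ)`. [folklore] -/
def Dgen (c : ℝ) : ℝ := c * (1 + c) / ((1 + 2 * c) * Delta c)

/-- **The gauge-fixed star received sum** `R_G(β) = 6c(1+c)/(1 − 4c − 6c²)`, `c = β/4`
(`GAUGE-STAR.md` (4.1)). [folklore] -/
def gaugeR (β : ℝ) : ℝ := 6 * (β / 4) * (1 + β / 4) / Delta (β / 4)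

/-! ### The resolvent equations `w = e_b + c·Adj·w`, reduced by symmetry

Links other than `a`: `ā` (adjacent to all six others), `b` and `b̄` (each adjacent to `ā` and the
four generic links), and four generic links `g` (each adjacent to `ā`, `b`, `b̄` and two generic). -/

/-- `Δ(c) > 0` for `0 ≤ c ≤ 7/40` (all `β_W ≤ 7/10`). [folklore] -/
theorem Delta_pos {c : ℝ} (h0 : 0 ≤ c) (h1 : c ≤ 7 / 40) : 0 < Delta c := by
  unfold Delta; nlinarith

/-- Row `ā` of the resolvent equation: `D_āb = c·(D_bb + D_b̄b + 4 D_gb)`. [folklore] -/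
theorem colB_eq_abar {c : ℝ} (h0 : 0 ≤ c) (h1 : c ≤ 7 / 40) :
    Dabar c = c * (Dbb c + Dbbar c + 4 * Dgen c) := by
  have hΔ := Delta_pos h0 h1
  have h2 : (0 : ℝ) < 1 + 2 * c := by linarith
  unfold Dabar Dbb Dbbar Dgen
  field_simp
  unfold Delta
  ring

/-- Row `b` of the resolvent equation: `D_bb = 1 + c·(D_āb + 4 D_gb)`. [folklore] -/
theorem colB_eq_b {c : ℝ} (h0 : 0 ≤ c) (h1 : c ≤ 7 / 40) :
    Dbb c = 1 + c * (Dabar c + 4 * Dgen c) := by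
  have hΔ := Delta_pos h0 h1
  have h2 : (0 : ℝ) < 1 + 2 * c := by linarith
  unfold Dabar Dbb Dgen
  field_simp
  unfold Delta
  ring

/-- Row `b̄` of the resolvent equation: `D_b̄b = c·(D_āb + 4 D_gb)`. [folklore] -/
theorem colB_eq_bbar {c : ℝ} (h0 : 0 ≤ c) (h1 : c ≤ 7 / 40) :
    Dbbar c = c * (Dabar c + 4 * Dgen c) := by
  have hΔ := Delta_pos h0 h1
  have h2 : (0 : ℝ) < 1 + 2 * c := by linarith
  unfold Dabar Dbbar Dgen
  field_simp
  ring

/-- Row `g` (generic) of the resolvent equation: `D_gb = c·(D_āb + D_bb + D_b̄b + 2 D_gb)`.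
[folklore] -/
theorem colB_eq_gen {c : ℝ} (h0 : 0 ≤ c) (h1 : c ≤ 7 / 40) :
    Dgen c = c * (Dabar c + Dbb c + Dbbar c + 2 * Dgen c) := by
  have hΔ := Delta_pos h0 h1
  have h2 : (0 : ℝ) < 1 + 2 * c := by linarith
  unfold Dabar Dbb Dbbar Dgen
  field_simp
  unfold Delta
  ring

/-- The resolvent column is nonnegative below the pole (so it is a nonnegative super-solution
`c·Adj·w + e_b ≤ w` in the sense of Föllmer's estimate). [folklore] -/
theorem colB_nonneg {c : ℝ} (h0 : 0 ≤ c) (h1 : c ≤ 7 / 40) :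
    0 ≤ Dbb c ∧ 0 ≤ Dbbar c ∧ 0 ≤ Dabar c ∧ 0 ≤ Dgen c := by
  have hΔ := Delta_pos h0 h1
  have h2 : (0 : ℝ) < 1 + 2 * c := by linarith
  unfold Dbb Dbbar Dabar Dgen
  refine ⟨?_, ?_, ?_, ?_⟩ <;> positivity

/-! ### The 48-position count and the closed form -/

/-- **The count**: `R_G(β) = c·(6 D_bb + 6 D_āb + 6 D_b̄b + 24 D_gb)` with `c = β/4` — a given star
link is seen in position `b` by 6 ordered pairs, in position `ā` by 6, in position `b̄` by 6, in
generic position by 24 (and in position `a`, weight `0`, by 6). [folklore] -/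
theorem gaugeR_eq_count {β : ℝ} (h0 : 0 ≤ β) (h1 : β ≤ 7 / 10) :
    gaugeR β = (β / 4) * (6 * Dbb (β / 4) + 6 * Dabar (β / 4) + 6 * Dbbar (β / 4)
      + 24 * Dgen (β / 4)) := by
  have hc0 : 0 ≤ β / 4 := by positivity
  have hc1 : β / 4 ≤ 7 / 40 := by linarith
  have hΔ := Delta_pos hc0 hc1
  have h2 : (0 : ℝ) < 1 + 2 * (β / 4) := by linarith
  unfold gaugeR Dbb Dabar Dbbar Dgen
  field_simp
  unfold Delta
  ring

/-! ### The exact threshold -/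

/-- `R_G(β) < 1 ↔ 3β² + 10β < 4` for `0 ≤ β ≤ 7/10` (i.e. `12c² + 10c < 1`, `c = β/4`). [folklore] -/
theorem gaugeR_lt_one_iff {β : ℝ} (h0 : 0 ≤ β) (h1 : β ≤ 7 / 10) :
    gaugeR β < 1 ↔ 3 * β ^ 2 + 10 * β < 4 := by
  have hc0 : 0 ≤ β / 4 := by positivity
  have hc1 : β / 4 ≤ 7 / 40 := by linarith
  have hΔ := Delta_pos hc0 hc1
  unfold gaugeR
  rw [div_lt_one hΔ]
  unfold Delta
  constructor <;> intro h <;> nlinarith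

/-- **The exact threshold**: for `0 ≤ β ≤ 7/10`, `R_G(β) < 1 ↔ β < (√37 − 5)/3 = 0.36092…`.
[folklore] -/
theorem gaugeR_lt_one_iff_lt_sqrt {β : ℝ} (h0 : 0 ≤ β) (h1 : β ≤ 7 / 10) :
    gaugeR β < 1 ↔ β < (Real.sqrt 37 - 5) / 3 := by
  rw [gaugeR_lt_one_iff h0 h1]
  have hs0 : 0 ≤ Real.sqrt 37 := Real.sqrt_nonneg 37
  have hs2 : Real.sqrt 37 ^ 2 = 37 := Real.sq_sqrt (by norm_num)
  constructor
  · intro h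
    -- `(3β + 5)² < 37 = (√37)²` and both bases are nonnegative
    by_contra hneg
    have h5 : Real.sqrt 37 ≤ 3 * β + 5 := by linarith [not_lt.mp hneg]
    nlinarith [mul_le_mul h5 h5 hs0 (by linarith)]
  · intro h
    have h5 : 3 * β + 5 < Real.sqrt 37 := by linarith
    have h6 : 0 ≤ 3 * β + 5 := by linarith
    nlinarith [mul_lt_mul'' h5 h5 h6 h6]

/-- Every `0 ≤ β ≤ 9/25 = 0.36` has `R_G(β) < 1`. [folklore] -/
theorem gaugeR_lt_one_of_le {β : ℝ} (h0 : 0 ≤ β) (h1 : β ≤ 9 / 25) : gaugeR β < 1 := by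
  rw [gaugeR_lt_one_iff h0 (by linarith)]
  nlinarith

/-! ### Rows (exact rational values) -/

/-- `R_G(2/9) = 19/41` (the single-site front; `0.4634`). [folklore] -/
theorem gaugeR_twoNinths : gaugeR (2 / 9) = 19 / 41 := by
  unfold gaugeR Delta; norm_num

/-- `R_G(1/4) = 17/31` (`0.5484`). [folklore] -/
theorem gaugeR_quarter : gaugeR (1 / 4) = 17 / 31 := by
  unfold gaugeR Delta; norm_num

/-- `R_G(11/40) = 5643/8917` (`0.6328`; the cell's earlier record row). [folklore] -/
theorem gaugeR_11_40 : gaugeR (11 / 40) = 5643 / 8917 := by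
  unfold gaugeR Delta; norm_num

/-- `R_G(2/7) = 45/67` (`0.6716`; the SC-c front). [folklore] -/
theorem gaugeR_twoSevenths : gaugeR (2 / 7) = 45 / 67 := by
  unfold gaugeR Delta; norm_num

/-- `R_G(3/10) = 387/533` (`0.7261`). [folklore] -/
theorem gaugeR_threeTenths : gaugeR (3 / 10) = 387 / 533 := by
  unfold gaugeR Delta; norm_num

/-- `R_G(1/3) = 13/15` (`0.8667`; the end of the kernel range of the quarter modulus). [folklore] -/
theorem gaugeR_oneThird : gaugeR (1 / 3) = 13 / 15 := by
  unfold gaugeR Delta; norm_num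

/-- `R_G(7/20) = 1827/1933` (`0.9452`). [folklore] -/
theorem gaugeR_7_20 : gaugeR (7 / 20) = 1827 / 1933 := by
  unfold gaugeR Delta; norm_num

/-- `R_G(9/25) = 2943/2957 < 1` (`0.9953`). [folklore] -/
theorem gaugeR_9_25 : gaugeR (9 / 25) = 2943 / 2957 := by
  unfold gaugeR Delta; norm_num

/-- **Where this bookkeeping ends**: `1 ≤ R_G(13/36)` (`13/36 = 0.3611 > (√37 − 5)/3`). [folklore] -/
theorem one_le_gaugeR_13_36 : 1 ≤ gaugeR (13 / 36) := by
  unfold gaugeR Delta; norm_num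

/-- The Dobrushin–Shlosman clustering rate `κ₁ = (1 − γ₀)²/(2(2γ₀N⋆ + 1))` at `N⋆ = 8`,
`γ₀ = R_G(1/3) = 13/15`: `κ₁ = 2/3345` (`5.98·10⁻⁴` per profile step). [folklore] -/
theorem rate_oneThird :
    (1 - gaugeR (1 / 3)) ^ 2 / (2 * (2 * gaugeR (1 / 3) * 8 + 1)) = 2 / 3345 := by
  rw [gaugeR_oneThird]; norm_num

end Summit.Ventures.YMGap.StarWindowGauge

end
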